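import Summits.CriticalPhenomena.PercolationContinuityZ3.Theorems.Transplant.AutChartOrbitsCriticalContinuity
import Summits.CriticalPhenomena.PercolationContinuityZ3.Theorems.Transplant.HeisenbergFrmCustomersHolds
import HarnessLib

/-!
# A NON-VERTEX-TRANSITIVE graph of polynomial growth with `θ(p_c) = 0`, UNCONDITIONALLY: the DECORATED HEISENBERG BILAYER — two copies of `Cay(H₃(ℤ); a, b)`,
# the second decorated with the central bonds `h ∼ hc`, joined by rungs — via the ORBIT THEOREM with two `H₃(ℤ)`-orbits

builds on p205010 (kernel theorem, internal audit signed; external expert review pending): the unconditional theorem of this file runs through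
`AutChart.criticalContinuity_of_autSubgroup_finite_orbits` («AutChartOrbitsCriticalContinuity», p493117), which builds on p205010 through the aligned multi-type
scaled node (p490798) and the GEN node with proxies (p486426).  Lane `prim-bschramm`, seat `prim-bschramm-p3` gen 28 (design owner; P3-NILPOTENT §20.7 customer
(c1′)).  Helper file (`--supports stmt-CriticalPhenomena-4575 --as helper`).

WHY (class C2 of the lane's charter = polynomial-growth graphs; Benjamini–Schramm's Conjecture 4 is stated for QUASI-transitive graphs).  Every class-C2 row of the
tree so far is a CAYLEY graph or a vertex-transitive product; the refuter's rule (P5-SHARPNESS §59.3) asks for an Aut-level reason before any graph is called outside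
the one-type nodes.  Here the reason is the DEGREE: the graph `X` on `H₃(ℤ) × {0,1}` with bonds `(h,j) ∼ (ha^{±1}, j)`, `(h,j) ∼ (hb^{±1}, j)` (both sheets),
`(h,1) ∼ (hc^{±1}, 1)` (sheet `1` only; `c = [a,b]` central) and rungs `(h,0) ∼ (h,1)` has degree `5` on sheet `0` and degree `7` at `(1,1)`
(`degree_sheet0_le`, `degree_one_one`), so NO automorphism maps `(1,0)` to `(1,1)` (`not_exists_iso_apply`): `X` is not vertex-transitive, hence carries no
one-type skeleton and is no Cayley graph; it is quasi-transitive (two orbits of the left `H₃(ℤ)`-action), connected, of polynomial growth (degree 4).  The orbit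
theorem applies with `A :=` the left translations `≤ Aut(X)`, transversal `{(1,0), (1,1)}`, chart = the abelianisation `(x, y)` of the `H₃`-coordinate (translated
by `A`, constant on the transversal), `N = 1` (every bond changes the chart by a letter of sup-norm `≤ 1`; the `a^{±1}`, `b^{±1}` bonds are the four exact unit
steps at every vertex):  **`Heis3Bilayer.criticalContinuity : ∀ v, θ_v(p_c(X)) = 0`** — no cylinder, growth or uniqueness hypothesis is verified here (the orbit
theorem carries them).
[cite: BenjaminiSchramm1996, Conj. 4; §2 (quasi-transitive graphs)] [cite: KozmaNitzan2024, §4 p. 16 (Lemma 8)]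
-/

noncomputable section

namespace Summit.CriticalPhenomena.PercolationContinuityZ3.Theorems.Transplant

open MeasureTheory Literature.Probability.Percolation Literature.Probability.LatticeModels SimpleGraph
open scoped Classical

namespace Heis3Bilayer

open Heis3 (gA gB gC φ φ_mul)

/-! ## §1 The decorated bilayer -/

/-- The vertices: an element of `H₃(ℤ)` and a sheet. [folklore] -/
abbrev Vtx : Type := Heis3 × Fin 2

/-- **The decorated Heisenberg bilayer**: generating relation = a right `a`- or `b`-step inside a sheet, a right `c`-step inside sheet `1`, or a rung `(h,0) ↦ (h,1)`.
[cite: BenjaminiSchramm1996, §2 (quasi-transitive graphs)] -/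
def graph : SimpleGraph Vtx :=
  SimpleGraph.fromRel fun a b =>
    (b.2 = a.2 ∧ (b.1 = a.1 * gA ∨ b.1 = a.1 * gB)) ∨ (a.2 = 1 ∧ b.2 = 1 ∧ b.1 = a.1 * gC) ∨ (a.2 = 0 ∧ b.2 = 1 ∧ b.1 = a.1)

/-- Adjacency unfolded. [folklore] -/
theorem adj_iff (a b : Vtx) : graph.Adj a b ↔ a ≠ b ∧
    (((b.2 = a.2 ∧ (b.1 = a.1 * gA ∨ b.1 = a.1 * gB)) ∨ (a.2 = 1 ∧ b.2 = 1 ∧ b.1 = a.1 * gC) ∨ (a.2 = 0 ∧ b.2 = 1 ∧ b.1 = a.1)) ∨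
      ((a.2 = b.2 ∧ (a.1 = b.1 * gA ∨ a.1 = b.1 * gB)) ∨ (b.2 = 1 ∧ a.2 = 1 ∧ a.1 = b.1 * gC) ∨ (b.2 = 0 ∧ a.2 = 1 ∧ a.1 = b.1))) :=
  SimpleGraph.fromRel_adj _ _ _

/-- The letters are not the identity. [folklore] -/
theorem gA_ne_one : gA ≠ 1 := by decide
/-- The letters are not the identity. [folklore] -/
theorem gB_ne_one : gB ≠ 1 := by decide
/-- The letters are not the identity. [folklore] -/
theorem gC_ne_one : gC ≠ 1 := by decide

/-- A right step by a non-trivial letter moves the vertex. [folklore] -/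
theorem ne_mul (h : Heis3) (j : Fin 2) {g : Heis3} (hg : g ≠ 1) : ((h, j) : Vtx) ≠ (h * g, j) := fun e => by
  have e1 : h * 1 = h * g := by rw [mul_one]; exact congrArg Prod.fst e
  exact hg (mul_left_cancel e1).symm

/-- `(h, j) ∼ (h a, j)`. [folklore] -/
theorem adj_mulA (h : Heis3) (j : Fin 2) : graph.Adj (h, j) (h * gA, j) :=
  (adj_iff _ _).2 ⟨ne_mul h j gA_ne_one, Or.inl (Or.inl ⟨rfl, Or.inl rfl⟩)⟩

/-- `(h, j) ∼ (h b, j)`. [folklore] -/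
theorem adj_mulB (h : Heis3) (j : Fin 2) : graph.Adj (h, j) (h * gB, j) :=
  (adj_iff _ _).2 ⟨ne_mul h j gB_ne_one, Or.inl (Or.inl ⟨rfl, Or.inr rfl⟩)⟩

/-- `(h, j) ∼ (h a⁻¹, j)`. [folklore] -/
theorem adj_mulA' (h : Heis3) (j : Fin 2) : graph.Adj (h, j) (h * gA⁻¹, j) := by
  have := (adj_mulA (h * gA⁻¹) j).symm
  rwa [inv_mul_cancel_right] at this

/-- `(h, j) ∼ (h b⁻¹, j)`. [folklore] -/
theorem adj_mulB' (h : Heis3) (j : Fin 2) : graph.Adj (h, j) (h * gB⁻¹, j) := by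
  have := (adj_mulB (h * gB⁻¹) j).symm
  rwa [inv_mul_cancel_right] at this

/-- `(h, 1) ∼ (h c, 1)` (the decoration of sheet `1`). [folklore] -/
theorem adj_mulC (h : Heis3) : graph.Adj (h, 1) (h * gC, 1) :=
  (adj_iff _ _).2 ⟨ne_mul h 1 gC_ne_one, Or.inl (Or.inr (Or.inl ⟨rfl, rfl, rfl⟩))⟩

/-- `(h, 1) ∼ (h c⁻¹, 1)`. [folklore] -/
theorem adj_mulC' (h : Heis3) : graph.Adj (h, 1) (h * gC⁻¹, 1) := by
  have := (adj_mulC (h * gC⁻¹)).symm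
  rwa [inv_mul_cancel_right] at this

/-- The rung `(h, 0) ∼ (h, 1)`. [folklore] -/
theorem adj_rung (h : Heis3) : graph.Adj (h, 0) (h, 1) :=
  (adj_iff _ _).2 ⟨fun e => by simpa using congrArg Prod.snd e, Or.inl (Or.inr (Or.inr ⟨rfl, rfl, rfl⟩))⟩

/-- The rung read from either sheet: `(h, j) ∼ (h, 1 − j)`. [folklore] -/
theorem adj_rung_sub (h : Heis3) (j : Fin 2) : graph.Adj (h, j) (h, 1 - j) := by
  fin_cases j
  · exact adj_rung h
  · exact (adj_rung h).symm

/-- The candidate neighbours of `(h, j)`: the four `a^{±1}`, `b^{±1}` steps, the rung, and on sheet `1` the two `c^{±1}` steps. [folklore] -/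
def nbrs (a : Vtx) : Finset Vtx :=
  {(a.1 * gA, a.2), (a.1 * gB, a.2), (a.1 * gA⁻¹, a.2), (a.1 * gB⁻¹, a.2), (a.1, 1 - a.2)} ∪ (if a.2 = 1 then {(a.1 * gC, a.2), (a.1 * gC⁻¹, a.2)} else ∅)

/-- Every neighbour is a candidate. [folklore] -/
theorem mem_nbrs_of_adj {a b : Vtx} (h : graph.Adj a b) : b ∈ nbrs a := by
  obtain ⟨v, j⟩ := a
  obtain ⟨w, k⟩ := b
  obtain ⟨-, h | h⟩ := (adj_iff _ _).1 h
  · rcases h with ⟨hk, hw⟩ | ⟨hj, hk, hw⟩ | ⟨hj, hk, hw⟩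
    · simp only at hk hw
      subst hk
      rcases hw with rfl | rfl <;> simp [nbrs]
    · simp only at hj hk hw
      subst hj hk hw
      simp [nbrs]
    · simp only at hj hk hw
      subst hj hk hw
      simp [nbrs]
  · rcases h with ⟨hk, hw⟩ | ⟨hk, hj, hw⟩ | ⟨hk, hj, hw⟩
    · simp only at hk hw
      subst hk
      rcases hw with hw | hw
      · have : w = v * gA⁻¹ := by rw [hw, mul_inv_cancel_right]
        subst this; simp [nbrs]
      · have : w = v * gB⁻¹ := by rw [hw, mul_inv_cancel_right]
        subst this; simp [nbrs]
    · simp only at hk hj hw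
      subst hk hj
      have : w = v * gC⁻¹ := by rw [hw, mul_inv_cancel_right]
      subst this; simp [nbrs]
    · simp only at hk hj hw
      subst hk hj hw
      simp [nbrs]

/-- Conversely every candidate is a neighbour. [folklore] -/
theorem adj_of_mem_nbrs {a b : Vtx} (h : b ∈ nbrs a) : graph.Adj a b := by
  obtain ⟨v, j⟩ := a
  rw [nbrs, Finset.mem_union] at h
  rcases h with h | h
  · simp only [Finset.mem_insert, Finset.mem_singleton] at h
    rcases h with rfl | rfl | rfl | rfl | rfl
    · exact adj_mulA v j
    · exact adj_mulB v j
    · exact adj_mulA' v j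
    · exact adj_mulB' v j
    · exact adj_rung_sub v j
  · by_cases hj : j = 1
    · subst hj
      simp only [if_true, Finset.mem_insert, Finset.mem_singleton] at h
      rcases h with rfl | rfl
      · exact adj_mulC v
      · exact adj_mulC' v
    · simp [hj] at h

/-- The neighbour set lies in the candidate set. [folklore] -/
theorem neighborSet_subset (a : Vtx) : graph.neighborSet a ⊆ ↑(nbrs a) := fun _ hb => mem_nbrs_of_adj hb

/-- `X` is locally finite. [folklore] -/
instance graph_locallyFinite : graph.LocallyFinite := fun a => ((Finset.finite_toSet _).subset (neighborSet_subset a)).fintype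

/-- The neighbours of a vertex are exactly the candidates. [folklore] -/
theorem neighborFinset_eq (a : Vtx) : graph.neighborFinset a = nbrs a :=
  Finset.ext fun _ => ⟨fun hb => mem_nbrs_of_adj ((mem_neighborFinset _ _ _).1 hb), fun hb => (mem_neighborFinset _ _ _).2 (adj_of_mem_nbrs hb)⟩

/-- **Degree `≤ 5` on sheet `0`.** [folklore] -/
theorem degree_sheet0_le (h : Heis3) : graph.degree (h, 0) ≤ 5 := by
  rw [← card_neighborFinset_eq_degree, neighborFinset_eq]
  unfold nbrs
  simp only [Fin.isValue, zero_ne_one, if_false, Finset.union_empty]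
  refine (Finset.card_insert_le _ _).trans (Nat.succ_le_succ ?_)
  refine (Finset.card_insert_le _ _).trans (Nat.succ_le_succ ?_)
  refine (Finset.card_insert_le _ _).trans (Nat.succ_le_succ ?_)
  refine (Finset.card_insert_le _ _).trans (Nat.succ_le_succ ?_)
  rw [Finset.card_singleton]

/-- **Degree `7` at `(1, 1)`** (the seven candidates are distinct). [folklore] -/
theorem degree_one_one : graph.degree ((1 : Heis3), (1 : Fin 2)) = 7 := by
  rw [← card_neighborFinset_eq_degree, neighborFinset_eq]
  decide

/-- **`X` is NOT vertex-transitive**: no automorphism maps `(1, 0)` (degree `≤ 5`) to `(1, 1)` (degree `7`) — so `X` is no Cayley graph and carries no one-type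
skeleton (the Aut-level reason the refuter's rule asks for). [this work] -/
theorem not_exists_iso_apply : ¬ ∃ α : graph ≃g graph, α ((1 : Heis3), (0 : Fin 2)) = ((1 : Heis3), (1 : Fin 2)) := by
  rintro ⟨α, hα⟩
  have h1 := Iso.degree_eq α ((1 : Heis3), (0 : Fin 2))
  rw [hα, degree_one_one] at h1
  have h2 := degree_sheet0_le (1 : Heis3)
  omega

/-- Along a bond the chart changes by a letter of sup-norm `≤ 1`. [folklore] -/
theorem abs_sub_le {a b : Vtx} (h : graph.Adj a b) (i : Fin 2) : |φ b.1 i - φ a.1 i| ≤ 1 := by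
  have hb := mem_nbrs_of_adj h
  obtain ⟨v, j⟩ := a
  rw [nbrs, Finset.mem_union] at hb
  rcases hb with hb | hb
  · simp only [Finset.mem_insert, Finset.mem_singleton] at hb
    rcases hb with rfl | rfl | rfl | rfl | rfl <;> fin_cases i <;> simp [φ, gA, gB]
  · by_cases hj : j = 1
    · subst hj
      simp only [if_true, Finset.mem_insert, Finset.mem_singleton] at hb
      rcases hb with rfl | rfl <;> fin_cases i <;> simp [φ, gC]
    · simp [hj] at hb

/-! ## §2 Frames: the left translations by `H₃(ℤ)`, a subgroup of `Aut(X)` with two orbits; connectedness -/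

/-- Left translation preserves adjacency. [folklore] -/
theorem adj_leftMul (g : Heis3) {a b : Vtx} (h : graph.Adj a b) : graph.Adj (g * a.1, a.2) (g * b.1, b.2) := by
  have hb := mem_nbrs_of_adj h
  obtain ⟨v, j⟩ := a
  rw [nbrs, Finset.mem_union] at hb
  rcases hb with hb | hb
  · simp only [Finset.mem_insert, Finset.mem_singleton] at hb
    rcases hb with rfl | rfl | rfl | rfl | rfl <;> simp only
    · rw [← mul_assoc]; exact adj_mulA _ _
    · rw [← mul_assoc]; exact adj_mulB _ _
    · rw [← mul_assoc]; exact adj_mulA' _ _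
    · rw [← mul_assoc]; exact adj_mulB' _ _
    · exact adj_rung_sub _ _
  · by_cases hj : j = 1
    · subst hj
      simp only [if_true, Finset.mem_insert, Finset.mem_singleton] at hb
      rcases hb with rfl | rfl <;> simp only
      · rw [← mul_assoc]; exact adj_mulC _
      · rw [← mul_assoc]; exact adj_mulC' _
    · simp [hj] at hb

/-- **Left translation** `(h, j) ↦ (g h, j)` is an automorphism of `X`. [cite: BenjaminiSchramm1996, §2] -/
def leftIso (g : Heis3) : graph ≃g graph where
  toEquiv := Equiv.prodCongr (Equiv.mulLeft g) (Equiv.refl _)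
  map_rel_iff' := by
    intro a b
    show graph.Adj (g * a.1, a.2) (g * b.1, b.2) ↔ graph.Adj a b
    refine ⟨fun h => ?_, adj_leftMul g⟩
    have := adj_leftMul g⁻¹ h
    simpa using this

/-- `leftIso g (h, j) = (g h, j)`. [folklore] -/
@[simp] theorem leftIso_apply (g : Heis3) (a : Vtx) : leftIso g a = (g * a.1, a.2) := rfl

/-- The left translations as a homomorphism `H₃(ℤ) → Aut(X)`. [folklore] -/
def leftHom : Heis3 →* (graph ≃g graph) where
  toFun := leftIso
  map_one' := RelIso.ext fun a => by simp
  map_mul' g g' := RelIso.ext fun a => by simp [mul_assoc]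

/-- **The frames**: the subgroup `A ≤ Aut(X)` of left translations. [cite: BenjaminiSchramm1996, §2] -/
def transl : Subgroup (graph ≃g graph) := leftHom.range

/-- Membership in `A`: `α = leftIso g` for some `g`. [folklore] -/
theorem mem_transl {α : graph ≃g graph} : α ∈ transl ↔ ∃ g : Heis3, leftIso g = α := by
  rw [transl, MonoidHom.mem_range]; rfl

/-- Elements of `H₃(ℤ)` reachable inside a sheet form a subgroup containing `a, b` — so every vertex of a sheet is joined to `(1, j)`. [folklore] -/
theorem reachable_sheet (h : Heis3) (j : Fin 2) : graph.Reachable ((1 : Heis3), j) (h, j) := by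
  have hmem : h ∈ Subgroup.closure (({gA, gB} : Finset Heis3) : Set Heis3) := by
    rw [Heis3.closure_eq_top_of_mem (S := {gA, gB}) (by simp) (by simp)]; exact Subgroup.mem_top h
  induction hmem using Subgroup.closure_induction with
  | mem x hx =>
    simp only [Finset.coe_insert, Finset.coe_singleton, Set.mem_insert_iff, Set.mem_singleton_iff] at hx
    rcases hx with rfl | rfl
    · simpa using (adj_mulA 1 j).reachable
    · simpa using (adj_mulB 1 j).reachable
  | one => exact Reachable.refl _
  | mul x y _ _ hx hy =>
    have hy' : graph.Reachable ((x * 1, j) : Vtx) (x * y, j) := hy.map (leftIso x).toHom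
    rw [mul_one] at hy'
    exact hx.trans hy'
  | inv x _ hx =>
    have hx' : graph.Reachable ((x⁻¹ * 1, j) : Vtx) (x⁻¹ * x, j) := hx.map (leftIso x⁻¹).toHom
    rw [mul_one, inv_mul_cancel] at hx'
    exact hx'.symm

/-- **`X` is connected.** [folklore] -/
theorem connected : graph.Connected := by
  haveI : Nonempty Vtx := ⟨((1 : Heis3), 0)⟩
  refine Connected.mk fun a b => ?_
  suffices H : ∀ w : Vtx, graph.Reachable ((1 : Heis3), 0) w from (H a).symm.trans (H b)
  rintro ⟨h, j⟩
  fin_cases j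
  · exact reachable_sheet h 0
  · exact (reachable_sheet h 0).trans (adj_rung h).reachable

/-- The transversal: the identity on each sheet. [folklore] -/
def reps : Finset Vtx := {((1 : Heis3), 0), ((1 : Heis3), 1)}

/-- A representative has `H₃`-coordinate `1`. [folklore] -/
theorem fst_eq_one_of_mem_reps {r : Vtx} (hr : r ∈ reps) : r.1 = 1 := by
  simp only [reps, Finset.mem_insert, Finset.mem_singleton] at hr
  rcases hr with rfl | rfl <;> rfl

/-- **`reps` meets every `A`-orbit at most once.** [folklore] -/
theorem reps_trans : ∀ r ∈ reps, ∀ r' ∈ reps, ∀ α ∈ transl, α r = r' → r = r' := by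
  intro r hr r' hr' α hα h
  obtain ⟨g, rfl⟩ := mem_transl.1 hα
  rw [leftIso_apply] at h
  have h2 := congrArg Prod.snd h
  dsimp only at h2
  exact Prod.ext (by rw [fst_eq_one_of_mem_reps hr, fst_eq_one_of_mem_reps hr']) h2

/-- **`reps` meets every `A`-orbit**: `(h, j) = leftIso h (1, j)`. [folklore] -/
theorem reps_cover : ∀ w : Vtx, ∃ α ∈ transl, ∃ r ∈ reps, α r = w := by
  rintro ⟨h, j⟩
  refine ⟨leftIso h, mem_transl.2 ⟨h, rfl⟩, ((1 : Heis3), j), ?_, by simp⟩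
  fin_cases j <;> simp [reps]

/-! ## §3 The chart `(h, j) ↦ (x(h), y(h))` and the unconditional theorem -/

/-- `φ 1 = 0`. [folklore] -/
theorem φ_one_eq : φ 1 = 0 := by funext i; fin_cases i <;> rfl

/-- The chart is translated by `A`: `φ (α w) = φ w + (φ (α t) − φ t)` with `t = (1, 0)`. [folklore] -/
theorem chart_transl : ∀ α ∈ transl, ∀ w : Vtx, φ (α w).1 = φ w.1 + (φ (α (((1 : Heis3), (0 : Fin 2)) : Vtx)).1 - φ (((1 : Heis3), (0 : Fin 2)) : Vtx).1) := by
  intro α hα w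
  obtain ⟨g, rfl⟩ := mem_transl.1 hα
  simp only [leftIso_apply, φ_mul, mul_one, φ_one_eq, sub_zero]
  rw [add_comm]

/-- The chart is constant on the transversal. [folklore] -/
theorem chart_reps : ∀ r ∈ reps, ∀ r' ∈ reps, φ r.1 = φ r'.1 := fun r hr r' hr' => by
  rw [fst_eq_one_of_mem_reps hr, fst_eq_one_of_mem_reps hr']

/-- `1`-range along the bonds at the representatives (indeed along every bond). [folklore] -/
theorem chart_lip : ∀ r ∈ reps, ∀ w : Vtx, graph.Adj r w → ∀ i : Fin 2, |φ w.1 i - φ r.1 i| ≤ ((1 : ℕ) : ℤ) :=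
  fun _ _ _ h i => by exact_mod_cast abs_sub_le h i

/-- **Exact unit steps along single bonds at every vertex**: the in-sheet `a^{±1}`, `b^{±1}` bonds. [this work] -/
theorem chart_step (a : Vtx) (i : Fin 2) (σ : ℤˣ) : ∃ w : Vtx, graph.Adj a w ∧ φ w.1 = φ a.1 + Pi.single i (((1 : ℕ) : ℤ) * σ) := by
  rcases Int.units_eq_one_or σ with rfl | rfl
  · fin_cases i
    · exact ⟨(a.1 * gA, a.2), adj_mulA a.1 a.2, by rw [φ_mul]; congr 1; funext k; fin_cases k <;> simp [φ, gA]⟩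
    · exact ⟨(a.1 * gB, a.2), adj_mulB a.1 a.2, by rw [φ_mul]; congr 1; funext k; fin_cases k <;> simp [φ, gB]⟩
  · fin_cases i
    · exact ⟨(a.1 * gA⁻¹, a.2), adj_mulA' a.1 a.2, by rw [φ_mul]; congr 1; funext k; fin_cases k <;> simp [φ, gA]⟩
    · exact ⟨(a.1 * gB⁻¹, a.2), adj_mulB' a.1 a.2, by rw [φ_mul]; congr 1; funext k; fin_cases k <;> simp [φ, gB]⟩

/-- **THEOREM (unconditional).  `θ_v(p_c) = 0` at every vertex of the decorated Heisenberg bilayer `X`** — a connected, NON-vertex-transitive, quasi-transitive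
graph of polynomial growth — by the orbit theorem with TWO orbits (the sheets) of the left translations `H₃(ℤ) ≤ Aut(X)`, chart = abelianisation, `N = 1`.
builds on p205010 (kernel theorem, internal audit signed; external expert review pending). [cite: BenjaminiSchramm1996, Conj. 4; §2 (quasi-transitive graphs)]
[cite: KozmaNitzan2024, §4 p. 16 (Lemma 8)] -/
theorem criticalContinuity (v : Vtx) : theta graph v (criticalProbIOf graph v) = 0 :=
  AutChart.criticalContinuity_of_autSubgroup_finite_orbits connected transl reps reps_trans reps_cover (fun a : Vtx => φ a.1)
    (t := (((1 : Heis3), (0 : Fin 2)) : Vtx)) chart_transl chart_reps 1 le_rfl chart_lip (fun r _ i σ => chart_step r i σ) v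

/-- **Conj. 4 in its own shape for `X`**: `p_c(X) < 1` AND `θ_v(p_c) = 0` at every vertex (`AutChart.conj4_of_autSubgroup_finite_orbits`).
builds on p205010 (kernel theorem, internal audit signed; external expert review pending). [cite: BenjaminiSchramm1996, Conj. 4; §2 Conj. 1] -/
theorem conj4 (v : Vtx) : criticalProb graph v < 1 ∧ theta graph v (criticalProbIOf graph v) = 0 :=
  AutChart.conj4_of_autSubgroup_finite_orbits connected transl reps reps_trans reps_cover (fun a : Vtx => φ a.1)
    (t := (((1 : Heis3), (0 : Fin 2)) : Vtx)) chart_transl chart_reps 1 le_rfl chart_lip (fun r _ i σ => chart_step r i σ) v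

/-- **… and the same-`p` drop at every vertex.** [cite: BenjaminiSchramm1996, Conj. 4] -/
theorem drop (v : Vtx) (p : unitInterval) (hθ : 0 < theta graph v p) : ∃ q : unitInterval, (q : ℝ) < p ∧ 0 < theta graph v q := by
  haveI : Countable Vtx := Literature.Barriers.CriticalPhenomena.countable_of_connected_of_locallyFinite graph connected v
  exact drop_at_of_critical graph v (P := fun _ => True) (fun _ => criticalContinuity v) p trivial hθ

end Heis3Bilayer

end Summit.CriticalPhenomena.PercolationContinuityZ3.Theorems.Transplant

end
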